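import Summits.RiemannHypothesis.RiemannHypothesis.Theses.NbTruncationBarrier
import HarnessLib

/-!
# Route NbTruncationBarrier (L6 «NB TRUNCATION BARRIER B21 + T45») — `Assembly` (RH-FREE)

Item stmt-RiemannHypothesis-21764: `SectionZeroRightOfHalf → SmallSections → NbTruncationBarrier`, by the case
split `M = 0 | 1 | 2 | ≥ 3` of the kernel's `truncFin_iff`, the last case through the IN-TREE zero floor
`Summit.RiemannHypothesis.RiemannHypothesis.Theorems.Splittings.NbTruncation.truncFloor_uniform_of_zero`
(Theorems/Splittings/NbTruncationA.lean, imported by the route file): a zero `ρ` of `ζ_M` with `Re ρ > 1/2` puts a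
floor `c > 0` under every truncated distance, so `FIN_M` fails at `ε = c`. This is the planner's kernel-checked
composition (rh-idea-3 g0, l6/Sketch.lean sha16 d0c8fab1d41d2034, `assembly_of_floor` + `assembly_holds`),
written against the route decls; both hypotheses are consumed. Standard axioms.
RH-free; no summit is proved by this; nothing here bears on the truth of RH.
-/

-- D-0017: `Summit.RiemannHypothesis.RiemannHypothesis.…` duplicates the namespace BY DESIGN (single-problem summit).
set_option linter.dupNamespace false

namespace Summit.RiemannHypothesis.RiemannHypothesis.Theorems.NbTruncationBarrier

/-- **`Assembly` (item stmt-RiemannHypothesis-21764) holds**: `M = 0, 1, 2` are the three conjuncts of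
`SmallSections`; for `M ≥ 3`, `SectionZeroRightOfHalf` gives a zero `ρ` of `ζ_M` right of `1/2` and the tree floor
`Splittings.NbTruncation.truncFloor_uniform_of_zero` a constant `c > 0` below every truncated distance,
contradicting `FIN_M` at `ε = c`. (Planner rh-idea-3's `assembly_holds`, d0c8fab1.) RH-free. -/
theorem assembly_proof :
    Summit.RiemannHypothesis.RiemannHypothesis.Theses.NbTruncationBarrier.Assembly := by
  intro h2 h3 M
  constructor
  · intro h
    by_contra hM
    rcases Nat.lt_or_ge M 3 with hlt | hge
    · have hM0 : M = 0 := by omega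
      subst hM0
      exact h3.2.2 h
    · obtain ⟨ρ, hζ, hρ⟩ := h2 M hge
      obtain ⟨c, hc, hfloor⟩ := Splittings.NbTruncation.truncFloor_uniform_of_zero hζ hρ
      obtain ⟨N, a, ha⟩ := h c hc
      exact absurd ((hfloor N a).trans_lt ha) (lt_irrefl _)
  · rintro (rfl | rfl)
    · exact h3.1
    · exact h3.2.1

end Summit.RiemannHypothesis.RiemannHypothesis.Theorems.NbTruncationBarrier
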